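import Summits.AtomisticToContinuum.HydrodynamicLimit.Theorems.LambertianContactSwapLambertianEulerExpectedWindowProductionTools
import Summits.AtomisticToContinuum.HydrodynamicLimit.Theorems.LambertianContactSwapLambertianEulerPathwiseProduction
import Summits.AtomisticToContinuum.HydrodynamicLimit.Theorems.LambertianContactSwapLambertianEulerCollisionCompensator
import Summits.AtomisticToContinuum.HydrodynamicLimit.Theorems.LambertianContactSwapLambertianEulerCollisionBudget
import Summits.AtomisticToContinuum.HydrodynamicLimit.Theorems.LambertianContactSwapLambertianEulerKlLedger
import Summits.AtomisticToContinuum.HydrodynamicLimit.Theorems.LambertianContactSwapLambertianWellPosedRegular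
import Summits.AtomisticToContinuum.HydrodynamicLimit.Theorems.OneFlightGossipEngineClampedCurrentsDockWindowBalance
import Literature.MathematicalPhysics.KineticTheory.LambertianRedrawNondegenerate
import HarnessLib

/-!
# The expected one-window entropy production of the Lambertian gas
# (crux `LambertianEuler`, stmt-AtomisticToContinuum-11854, line `Sketch`, stub `stub_expectedWindowProductionLambda`)

Helper file (`--supports`) of the crux
`Summit.AtomisticToContinuum.HydrodynamicLimit.Theses.LindebergRandomFuture.LambertianEuler` (routes
`LambertianContactSwap` / `LindebergRandomFuture` of `AtomisticToContinuum/HydrodynamicLimit`), line `Sketch`,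
registered stub `stub_expectedWindowProductionLambda` — the FORMULA half of the line's kernel (Yau's one-window
production estimate for the Lambertian gas `Λ`): the restarted window expectation
`E_{μ_s ⊗ γ^ℕ}[log ρ_{ψ_s}(q) − log ρ_{ψ_{s+h}}(Λ_h(q, ηs))]` of the relative-entropy ledger IS the explicit functional
`(log Zpos_{s+h} − log Zpos_s) − E_λ[∫_s^{s+h} Σ_i Dg_r((Λ_r)_i) dr] − E_λ[Σ_{m<K_{s+h}, s<t_{m+1}} compensated jump of Σ_i g]`
along one trajectory from time `0` (`λ = λ_N ⊗ γ^ℕ`), with both random variables integrable.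

Assembly of landed tools only: the two-time Markov law in Bochner form
(`…ExpectedWindowProductionTools.integral_twoTime_eq`), the canonical log-density on the hard-sphere domain
(`EntropyClockDock.log_canonicalDensity_localGibbsProfile`; `Λ` stays in the domain, `lambertFlow_mem_of_segment`),
the pathwise production identity (`…PathwiseProduction.stub_pathwiseProductionLambda`) off the null accumulation
set (`nonAccumulationLambda`), the collision compensator (`…CollisionCompensator.integral_sum_jump_eq_sum_compensator`)
for the clamped observable `F t = Σ_i g_{clamp t}` (jointly measurable, energy-dominated uniformly on the window:
`…ExpectedWindowProductionTools`), whose integrability input is the collision budget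
(`…CollisionBudget.stub_collisionBudgetIntegrableLambda` fed with `…CollisionIntensity.stub_collisionIntensityLambda`),
and domination of the streaming integral by the cubic growth of `Dg`
(`ClampedCurrentsDockWindowBalance.exists_abs_DgExp_le` / `abs_DgSum_le`), energy monotonicity of `Λ` and the
second/fourth Gaussian velocity moments of the local Gibbs law.

References: H.-T. Yau, *Relative entropy and hydrodynamics of Ginzburg–Landau models*, Lett. Math. Phys. 22
(1991) §2; S. Olla, S. R. S. Varadhan, H.-T. Yau, Comm. Math. Phys. 155 (1993) §3 (the ledger of the
relative-entropy method); H. Spohn, *Large Scale Dynamics of Interacting Particles* (1991), Part I §3.2.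
-/

noncomputable section

namespace Summit.AtomisticToContinuum.HydrodynamicLimit.Theorems.LambertianContactSwapLambertianEulerExpectedWindowProduction

open scoped BigOperators Topology ENNReal InnerProductSpace
open MeasureTheory ProbabilityTheory Filter Set InformationTheory
open Literature.MathematicalPhysics.KineticTheory
open Literature.Analysis.FluidPDE Literature.Analysis.FluidPDE.Alexander
open Literature.Analysis.FunctionSpaces
open Summit.AtomisticToContinuum.HydrodynamicLimit.Theorems.ClampedCurrentsDockPathwise (gExp gSum DgExp DgSum)
open Summit.AtomisticToContinuum.HydrodynamicLimit.Theorems.LambertianContactSwapLambertianEulerExpectedWindowProductionTools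
open Summit.AtomisticToContinuum.HydrodynamicLimit.Theorems.LambertianContactSwapSwapGapLiouvilleInvarianceLambda (nonAccumulationLambda)
open Summit.AtomisticToContinuum.HydrodynamicLimit.Theorems.LambertianContactSwapLambertianEulerTimeLedgerStopping
  (instant_succ_le_of_lt_lambertCount)
open LRestart (lambertFlow_mem_of_segment)

/-- **STUB `stub_expectedWindowProductionLambda`** (line `Sketch` of the crux `LambertianEuler`,
stmt-AtomisticToContinuum-11854; the FORMULA half of the v15 kernel of the line). **The expected one-window
entropy production of the Lambertian gas is an explicit functional.** For `0 < σ < 1/2`, continuous positive data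
profiles `(a₀, u₀, θ₀)`, a reference family `ψ_r = localGibbsLaw σ (a r) (u r) (θ r)` with profiles `a, θ > 0`, `u`
jointly smooth on `[0, T) × 𝕋³`, every `N`, `Φ`, and every window `0 ≤ s ≤ s + h < T`: (i) the windowed streaming
integral `∫_s^{s+h} Σ_i Dg_r((Λ_r)_i) dr` is `λ_N ⊗ γ^ℕ`-integrable; (ii) the sum over the counted collisions
`m < K_{s+h}` with `s < t_{m+1}` of the cosine-redraw-compensated jumps of `Σ_i g_{t_{m+1}}` at the exit configuration
is `λ_N ⊗ γ^ℕ`-integrable; (iii) `E_{μ_s ⊗ γ^ℕ}[log ρ_{ψ_s}(q) − log ρ_{ψ_{s+h}}(Λ_h(q, ηs))]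
= (log Zpos_{s+h} − log Zpos_s) − E[(i)] − E[(ii)]`. Proof: two-time law (`integral_twoTime_eq`), `log ρ_ψ = −log Zpos + Σ_i g`
on the domain (where `Λ` stays), the pathwise identity `stub_pathwiseProductionLambda` off the null accumulation set, the
raw jumps replaced by their compensators (`integral_sum_jump_eq_sum_compensator` at the clamped observable, integrability
from `stub_collisionBudgetIntegrableLambda` / `stub_collisionIntensityLambda`), the streaming integral dominated through the
cubic growth of `Dg`, energy monotonicity of `Λ` and Gaussian moments. [cite: Yau1991, §2] -/
theorem stub_expectedWindowProductionLambda :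
    ∀ {σ : ℝ}, 0 < σ → σ < 2⁻¹ → ∀ {a₀ θ₀ : T3 → ℝ} {u₀ : T3 → V3},
      Continuous a₀ → Continuous θ₀ → Continuous u₀ → (∀ x, 0 < a₀ x) → (∀ x, 0 < θ₀ x) →
      ∀ (T : ℝ) (N : ℕ) (Φ : HardSphereFlow (Torus.geometry (Fin 3)) (hsDiameter σ N) (N + 1))
        (a θ : ℝ → T3 → ℝ) (u : ℝ → T3 → V3),
        Literature.Analysis.FunctionSpaces.Torus.IsSmoothSpaceTimeOn (Set.Ico 0 T) a →
        Literature.Analysis.FunctionSpaces.Torus.IsSmoothSpaceTimeOn (Set.Ico 0 T) θ →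
        Literature.Analysis.FunctionSpaces.Torus.IsSmoothSpaceTimeOn (Set.Ico 0 T) u →
        (∀ t ∈ Set.Ico 0 T, ∀ x, 0 < a t x) → (∀ t ∈ Set.Ico 0 T, ∀ x, 0 < θ t x) →
        ∀ (s h : ℝ), 0 ≤ s → 0 ≤ h → s + h < T →
          Integrable (fun p : Config (N + 1) (Fin 3) T3 × (ℕ → V3) =>
              ∫ r in s..(s + h), DgSum T a θ u r (lambertFlow (Torus.geometry (Fin 3)) (hsDiameter σ N) p.2 p.1 r)) ((localGibbsLaw σ a₀ u₀ θ₀ N Φ).prod (lambertNoise (Fin 3))) ∧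
          Integrable (fun p : Config (N + 1) (Fin 3) T3 × (ℕ → V3) =>
              ∑ m ∈ Finset.range (lambertCount (Torus.geometry (Fin 3)) (hsDiameter σ N) p.2 p.1 (s + h)),
                if s < (lambertInstant (Torus.geometry (Fin 3)) (hsDiameter σ N) p.2 p.1 (m + 1)).toReal then
                  (∫ ξ, gSum a θ u (lambertInstant (Torus.geometry (Fin 3)) (hsDiameter σ N) p.2 p.1 (m + 1)).toReal
                      (lambertStepMap (Torus.geometry (Fin 3)) (incomingPairs (Torus.geometry (Fin 3)) (hsDiameter σ N)
                        (freeFlight (Torus.geometry (Fin 3)) (freeExitTime (Torus.geometry (Fin 3)) (hsDiameter σ N) (lambertStateAfter (Torus.geometry (Fin 3)) (hsDiameter σ N) p.2 p.1 m)).toReal (lambertStateAfter (Torus.geometry (Fin 3)) (hsDiameter σ N) p.2 p.1 m)))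
                        (freeFlight (Torus.geometry (Fin 3)) (freeExitTime (Torus.geometry (Fin 3)) (hsDiameter σ N) (lambertStateAfter (Torus.geometry (Fin 3)) (hsDiameter σ N) p.2 p.1 m)).toReal (lambertStateAfter (Torus.geometry (Fin 3)) (hsDiameter σ N) p.2 p.1 m)) ξ) ∂(stdGaussian V3)) -
                    gSum a θ u (lambertInstant (Torus.geometry (Fin 3)) (hsDiameter σ N) p.2 p.1 (m + 1)).toReal
                      (freeFlight (Torus.geometry (Fin 3)) (freeExitTime (Torus.geometry (Fin 3)) (hsDiameter σ N) (lambertStateAfter (Torus.geometry (Fin 3)) (hsDiameter σ N) p.2 p.1 m)).toReal (lambertStateAfter (Torus.geometry (Fin 3)) (hsDiameter σ N) p.2 p.1 m))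
                else 0) ((localGibbsLaw σ a₀ u₀ θ₀ N Φ).prod (lambertNoise (Fin 3))) ∧
          ∫ q, (Real.log (canonicalDensity (Torus.geometry (Fin 3)) (hsDiameter σ N) (N + 1)
                  (localGibbsProfile (a s) (u s) (θ s)) q.1) -
                Real.log (canonicalDensity (Torus.geometry (Fin 3)) (hsDiameter σ N) (N + 1)
                  (localGibbsProfile (a (s + h)) (u (s + h)) (θ (s + h)))
                  (lambertFlow (Torus.geometry (Fin 3)) (hsDiameter σ N) q.2 q.1 h)))
              ∂((((((localGibbsLaw σ a₀ u₀ θ₀ N Φ).prod (lambertNoise (Fin 3)))).map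
                (fun p => lambertFlow (Torus.geometry (Fin 3)) (hsDiameter σ N) p.2 p.1 s))).prod (lambertNoise (Fin 3))) =
            (Real.log (posPartition (a (s + h)) (hsDiameter σ N) (N + 1)) -
                Real.log (posPartition (a s) (hsDiameter σ N) (N + 1))) -
              (∫ p, (∫ r in s..(s + h), DgSum T a θ u r (lambertFlow (Torus.geometry (Fin 3)) (hsDiameter σ N) p.2 p.1 r)) ∂((localGibbsLaw σ a₀ u₀ θ₀ N Φ).prod (lambertNoise (Fin 3)))) -
              (∫ p, (∑ m ∈ Finset.range (lambertCount (Torus.geometry (Fin 3)) (hsDiameter σ N) p.2 p.1 (s + h)),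
                  if s < (lambertInstant (Torus.geometry (Fin 3)) (hsDiameter σ N) p.2 p.1 (m + 1)).toReal then
                    (∫ ξ, gSum a θ u (lambertInstant (Torus.geometry (Fin 3)) (hsDiameter σ N) p.2 p.1 (m + 1)).toReal
                        (lambertStepMap (Torus.geometry (Fin 3)) (incomingPairs (Torus.geometry (Fin 3)) (hsDiameter σ N)
                          (freeFlight (Torus.geometry (Fin 3)) (freeExitTime (Torus.geometry (Fin 3)) (hsDiameter σ N) (lambertStateAfter (Torus.geometry (Fin 3)) (hsDiameter σ N) p.2 p.1 m)).toReal (lambertStateAfter (Torus.geometry (Fin 3)) (hsDiameter σ N) p.2 p.1 m)))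
                          (freeFlight (Torus.geometry (Fin 3)) (freeExitTime (Torus.geometry (Fin 3)) (hsDiameter σ N) (lambertStateAfter (Torus.geometry (Fin 3)) (hsDiameter σ N) p.2 p.1 m)).toReal (lambertStateAfter (Torus.geometry (Fin 3)) (hsDiameter σ N) p.2 p.1 m)) ξ) ∂(stdGaussian V3)) -
                      gSum a θ u (lambertInstant (Torus.geometry (Fin 3)) (hsDiameter σ N) p.2 p.1 (m + 1)).toReal
                        (freeFlight (Torus.geometry (Fin 3)) (freeExitTime (Torus.geometry (Fin 3)) (hsDiameter σ N) (lambertStateAfter (Torus.geometry (Fin 3)) (hsDiameter σ N) p.2 p.1 m)).toReal (lambertStateAfter (Torus.geometry (Fin 3)) (hsDiameter σ N) p.2 p.1 m))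
                  else 0) ∂((localGibbsLaw σ a₀ u₀ θ₀ N Φ).prod (lambertNoise (Fin 3)))) := by
  intro σ hσ hσ' a₀ θ₀ u₀ ha₀ hθ₀ hu₀ ha₀0 hθ₀0 T N Φ a θ u ha hθ hu ha0 hθ0 s h hs hh hshT
  /- ── scalars, geometry, the window ── -/
  have hσ2 : σ ≤ 1 / 2 := by rw [one_div]; exact hσ'.le
  have hε : 0 < hsDiameter σ N := hsDiameter_pos hσ N
  have hε' : hsDiameter σ N < 2⁻¹ := (hsDiameter_le hσ.le N).trans_lt hσ'
  have hG : (Torus.geometry (Fin 3)).IsHardSphereRegular (hsDiameter σ N) := Torus.isHardSphereRegular_geometry hε'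
  have hGm : (Torus.geometry (Fin 3)).IsMeasurable := Torus.isMeasurable_geometry
  have hsb : s ≤ s + h := le_add_of_nonneg_right hh
  have hIcc : Set.Icc s (s + h) ⊆ Set.Ico 0 T := fun r hr => ⟨hs.trans hr.1, hr.2.trans_lt hshT⟩
  have hsW : s ∈ Set.Icc s (s + h) := ⟨le_rfl, hsb⟩
  have hbW : s + h ∈ Set.Icc s (s + h) := ⟨hsb, le_rfl⟩
  have hac : ∀ {t : ℝ}, t ∈ Set.Ico 0 T → Continuous (a t) := fun ht => (ha.isSmooth_slice ht).continuous
  have hθc : ∀ {t : ℝ}, t ∈ Set.Ico 0 T → Continuous (θ t) := fun ht => (hθ.isSmooth_slice ht).continuous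
  have huc : ∀ {t : ℝ}, t ∈ Set.Ico 0 T → Continuous (u t) := fun ht => (hu.isSmooth_slice ht).continuous
  /- ── the law `P = λ_N ⊗ γ^ℕ` ── -/
  haveI hPm : IsProbabilityMeasure (localGibbsLaw σ a₀ u₀ θ₀ N Φ) :=
    isProbabilityMeasure_localGibbsLaw ha₀ hθ₀ hu₀ ha₀0 hθ₀0 hσ2 N Φ
  have hPL : localGibbsLaw σ a₀ u₀ θ₀ N Φ ≪ liouville (Torus.geometry (Fin 3)) (N + 1) (hsDiameter σ N) := by
    rw [localGibbsLaw, particleLaw_eq]; exact withDensity_absolutelyContinuous _ _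
  have hacP : ((localGibbsLaw σ a₀ u₀ θ₀ N Φ).prod (lambertNoise (Fin 3))) ≪ (liouville (Torus.geometry (Fin 3)) (N + 1) (hsDiameter σ N)).prod (lambertNoise (Fin 3)) :=
    hPL.prod Measure.AbsolutelyContinuous.rfl
  -- a.e.: the collision instants do not accumulate; the flow stays in the hard-sphere domain
  have hacc : ∀ᵐ p ∂((localGibbsLaw σ a₀ u₀ θ₀ N Φ).prod (lambertNoise (Fin 3))), ∀ T' : ℝ, ∃ k, ENNReal.ofReal T' < lambertInstant (Torus.geometry (Fin 3)) (hsDiameter σ N) p.2 p.1 k :=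
    hacP.ae_le (nonAccumulationLambda _ hε hε' (N + 1))
  have hDom : ∀ᵐ p ∂((localGibbsLaw σ a₀ u₀ θ₀ N Φ).prod (lambertNoise (Fin 3))), ∀ r : ℝ, 0 ≤ r → (lambertFlow (Torus.geometry (Fin 3)) (hsDiameter σ N) p.2 p.1 r) ∈ hardSphereDomain (Torus.geometry (Fin 3)) (N + 1) (hsDiameter σ N) := by
    filter_upwards [hacc] with p hp
    exact fun r hr => lambertFlow_mem_of_segment (hp r) hr le_rfl
  have hΛ : ∀ r : ℝ, Measurable fun p : Config (N + 1) (Fin 3) T3 × (ℕ → V3) => (lambertFlow (Torus.geometry (Fin 3)) (hsDiameter σ N) p.2 p.1 r) := fun r =>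
    measurable_lambertFlow_hsDiameter hσ.le hσ' N r
  -- kinetic energy: integrable (with its square), non-increasing along `Λ`
  have hE1 : Integrable (fun p : Config (N + 1) (Fin 3) T3 × (ℕ → V3) => ∑ i, ‖(p.1 i).2‖ ^ 2) ((localGibbsLaw σ a₀ u₀ θ₀ N Φ).prod (lambertNoise (Fin 3))) :=
    (QuenchedCellClock.integrable_sum_norm_sq_localGibbsLaw ha₀ hθ₀ hu₀ (fun x => (ha₀0 x).le) hθ₀0 N Φ).comp_fst _
  have hE4 : Integrable (fun p : Config (N + 1) (Fin 3) T3 × (ℕ → V3) => ∑ i, ‖(p.1 i).2‖ ^ 4) ((localGibbsLaw σ a₀ u₀ θ₀ N Φ).prod (lambertNoise (Fin 3))) :=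
    (ClampedCurrentsDockWindowBalance.integrable_sum_norm_pow_four_localGibbsLaw ha₀ hθ₀ hu₀ (fun x => (ha₀0 x).le)
      hθ₀0 σ N Φ).comp_fst _
  have hEmono : ∀ (p : Config (N + 1) (Fin 3) T3 × (ℕ → V3)) (r : ℝ), ∑ i, ‖((lambertFlow (Torus.geometry (Fin 3)) (hsDiameter σ N) p.2 p.1 r) i).2‖ ^ 2 ≤ ∑ i, ‖(p.1 i).2‖ ^ 2 := by
    intro p r
    have hm := configEnergy_lambertFlow_le (G := (Torus.geometry (Fin 3))) (ε := (hsDiameter σ N)) p.2 p.1 r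
    simp only [configEnergy] at hm
    linarith
  /- ── (1) the one-body sums at the window ends are integrable ── -/
  have hGint : ∀ {t : ℝ}, t ∈ Set.Icc s (s + h) → Integrable (fun p : Config (N + 1) (Fin 3) T3 × (ℕ → V3) => gSum a θ u t (lambertFlow (Torus.geometry (Fin 3)) (hsDiameter σ N) p.2 p.1 t)) ((localGibbsLaw σ a₀ u₀ θ₀ N Φ).prod (lambertNoise (Fin 3))) := by
    intro t ht
    have htI := hIcc ht
    have hI := LambertianContactSwapLambertianEulerKlLedger.integrable_sum_oneBody_comp ((localGibbsLaw σ a₀ u₀ θ₀ N Φ).prod (lambertNoise (Fin 3))) (hac htI) (hθc htI) (huc htI)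
      (ha0 t htI) (hθ0 t htI) (hΛ t) hE1 (fun p => hEmono p t)
    simpa only [gSum, gExp] using hI
  /- ── (2) the canonical log-density on the domain ── -/
  have hlog : ∀ {t : ℝ}, t ∈ Set.Icc s (s + h) → ∀ {z : Config (N + 1) (Fin 3) T3}, z ∈ hardSphereDomain (Torus.geometry (Fin 3)) (N + 1) (hsDiameter σ N) →
      Real.log (canonicalDensity (Torus.geometry (Fin 3)) (hsDiameter σ N) (N + 1) (localGibbsProfile (a t) (u t) (θ t)) z) =
        -Real.log (posPartition (a t) (hsDiameter σ N) (N + 1)) + gSum a θ u t z := by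
    intro t ht z hz
    have htI := hIcc ht
    rw [EntropyClockDock.log_canonicalDensity_localGibbsProfile (hac htI) (hθc htI) (huc htI) (ha0 t htI) (hθ0 t htI) hσ2 N hz]
    simp only [gSum, gExp]
  /- ── (3) abbreviations for the collision bookkeeping ── -/
  have hKm : Measurable fun p : Config (N + 1) (Fin 3) T3 × (ℕ → V3) => lambertCount (Torus.geometry (Fin 3)) (hsDiameter σ N) p.2 p.1 (s + h) :=
    measurable_lambertCount hG hGm (s + h)
  have hZm : ∀ m, Measurable fun p : Config (N + 1) (Fin 3) T3 × (ℕ → V3) => lambertStateAfter (Torus.geometry (Fin 3)) (hsDiameter σ N) p.2 p.1 m :=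
    fun m => measurable_lambertStateAfter hG hGm m
  have hTm : ∀ m : ℕ, Measurable fun p : Config (N + 1) (Fin 3) T3 × (ℕ → V3) => (lambertInstant (Torus.geometry (Fin 3)) (hsDiameter σ N) p.2 p.1 (m + 1)).toReal := fun m =>
    (measurable_lambertInstant hG hGm (m + 1)).ennreal_toReal
  have hZpm : ∀ m : ℕ, Measurable fun p : Config (N + 1) (Fin 3) T3 × (ℕ → V3) => (freeFlight (Torus.geometry (Fin 3)) (freeExitTime (Torus.geometry (Fin 3)) (hsDiameter σ N) (lambertStateAfter (Torus.geometry (Fin 3)) (hsDiameter σ N) p.2 p.1 m)).toReal (lambertStateAfter (Torus.geometry (Fin 3)) (hsDiameter σ N) p.2 p.1 m)) := fun m =>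
    hGm.measurable_freeFlight₂.comp ((((measurable_freeExitTime hG hGm).comp (hZm m)).ennreal_toReal).prodMk (hZm m))
  have hZsm : ∀ m : ℕ, Measurable fun p : Config (N + 1) (Fin 3) T3 × (ℕ → V3) => lambertStateAfter (Torus.geometry (Fin 3)) (hsDiameter σ N) p.2 p.1 (m + 1) := fun m => hZm (m + 1)
  have hEZp : ∀ (m : ℕ) (p : Config (N + 1) (Fin 3) T3 × (ℕ → V3)), configEnergy (freeFlight (Torus.geometry (Fin 3)) (freeExitTime (Torus.geometry (Fin 3)) (hsDiameter σ N) (lambertStateAfter (Torus.geometry (Fin 3)) (hsDiameter σ N) p.2 p.1 m)).toReal (lambertStateAfter (Torus.geometry (Fin 3)) (hsDiameter σ N) p.2 p.1 m)) ≤ configEnergy p.1 := fun m p => by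
    rw [configEnergy_freeFlight]
    exact configEnergy_lambertStateAfter_le _ _ _
  have hEZs : ∀ (m : ℕ) (p : Config (N + 1) (Fin 3) T3 × (ℕ → V3)), configEnergy (lambertStateAfter (Torus.geometry (Fin 3)) (hsDiameter σ N) p.2 p.1 (m + 1)) ≤ configEnergy p.1 :=
    fun m p => configEnergy_lambertStateAfter_le _ _ _
  -- counted collisions after `s` happen inside the window
  have hT1W : ∀ p : Config (N + 1) (Fin 3) T3 × (ℕ → V3), (∃ k, ENNReal.ofReal (s + h) < lambertInstant (Torus.geometry (Fin 3)) (hsDiameter σ N) p.2 p.1 k) →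
      ∀ m, m < lambertCount (Torus.geometry (Fin 3)) (hsDiameter σ N) p.2 p.1 (s + h) → s < (lambertInstant (Torus.geometry (Fin 3)) (hsDiameter σ N) p.2 p.1 (m + 1)).toReal → (lambertInstant (Torus.geometry (Fin 3)) (hsDiameter σ N) p.2 p.1 (m + 1)).toReal ∈ Set.Icc s (s + h) := fun p hp m hm hsm =>
    ⟨hsm.le, ENNReal.toReal_le_of_le_ofReal (hs.trans hsb) (instant_succ_le_of_lt_lambertCount hp hm)⟩
  /- ── (4) the clamped observable and its compensator identity ── -/
  obtain ⟨Cg, hCg0, hCg⟩ := exists_abs_gExp_le_of_window ha hθ hu ha0 hθ0 hs hshT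
  -- the clamped observable, kept OPAQUE (an `obtain`ed function with its defining equation)
  obtain ⟨F, hF⟩ : ∃ F : ℝ → Config (N + 1) (Fin 3) T3 → ℝ, F = fun t w => gSum a θ u (max s (min t (s + h))) w := ⟨_, rfl⟩
  have hFm : Measurable (Function.uncurry F) := by
    rw [hF]; exact measurable_uncurry_gSum_clamp ha hθ hu ha0 hθ0 hs hh hshT
  have hclW : ∀ t : ℝ, max s (min t (s + h)) ∈ Set.Icc s (s + h) := fun t =>
    ⟨le_max_left _ _, max_le hsb (min_le_right _ _)⟩
  have hCf0 : 0 ≤ Cg * ((N : ℝ) + 3) := by positivity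
  have hFC : ∀ (t : ℝ) (w : Config (N + 1) (Fin 3) T3), |F t w| ≤ Cg * ((N : ℝ) + 3) * (1 + configEnergy w) := fun t w => by
    rw [hF]; exact abs_gSum_le_of_window hCg0 (hCg _ (hclW t)) w
  have hFt : ∀ (t : ℝ), t ∈ Set.Icc s (s + h) → ∀ w : Config (N + 1) (Fin 3) T3, F t w = gSum a θ u t w := fun t ht w => by
    simp only [hF, min_eq_left ht.2, max_eq_right ht.1]
  have hInt : Integrable (fun q : Config (N + 1) (Fin 3) T3 × (ℕ → V3) => ((lambertCount (Torus.geometry (Fin 3)) (hsDiameter σ N) q.2 q.1 (s + h) : ℝ) + 1) *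
      (1 + configEnergy q.1)) ((localGibbsLaw σ a₀ u₀ θ₀ N Φ).prod (lambertNoise (Fin 3))) :=
    LambertianContactSwapLambertianEulerCollisionBudget.stub_collisionBudgetIntegrableLambda
      LambertianContactSwapLambertianEulerCollisionIntensity.stub_collisionIntensityLambda hσ hσ' ha₀ hθ₀ hu₀ ha₀0 hθ₀0
      N Φ (s + h) (hs.trans hsb)
  have hacc' : ∀ᵐ p ∂((localGibbsLaw σ a₀ u₀ θ₀ N Φ).prod (lambertNoise (Fin 3))), ∃ k, ENNReal.ofReal (s + h) < lambertInstant (Torus.geometry (Fin 3)) (hsDiameter σ N) p.2 p.1 k := by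
    filter_upwards [hacc] with p hp using hp (s + h)
  have hcomp : ∫ p, (∑ m ∈ Finset.range (lambertCount (Torus.geometry (Fin 3)) (hsDiameter σ N) p.2 p.1 (s + h)), if s < (lambertInstant (Torus.geometry (Fin 3)) (hsDiameter σ N) p.2 p.1 (m + 1)).toReal then F (lambertInstant (Torus.geometry (Fin 3)) (hsDiameter σ N) p.2 p.1 (m + 1)).toReal (lambertStateAfter (Torus.geometry (Fin 3)) (hsDiameter σ N) p.2 p.1 (m + 1)) - F (lambertInstant (Torus.geometry (Fin 3)) (hsDiameter σ N) p.2 p.1 (m + 1)).toReal (freeFlight (Torus.geometry (Fin 3)) (freeExitTime (Torus.geometry (Fin 3)) (hsDiameter σ N) (lambertStateAfter (Torus.geometry (Fin 3)) (hsDiameter σ N) p.2 p.1 m)).toReal (lambertStateAfter (Torus.geometry (Fin 3)) (hsDiameter σ N) p.2 p.1 m)) else 0) ∂((localGibbsLaw σ a₀ u₀ θ₀ N Φ).prod (lambertNoise (Fin 3))) =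
      ∫ p, (∑ m ∈ Finset.range (lambertCount (Torus.geometry (Fin 3)) (hsDiameter σ N) p.2 p.1 (s + h)), if s < (lambertInstant (Torus.geometry (Fin 3)) (hsDiameter σ N) p.2 p.1 (m + 1)).toReal then (∫ ξ, F (lambertInstant (Torus.geometry (Fin 3)) (hsDiameter σ N) p.2 p.1 (m + 1)).toReal (lambertStepMap (Torus.geometry (Fin 3))
        (incomingPairs (Torus.geometry (Fin 3)) (hsDiameter σ N) (freeFlight (Torus.geometry (Fin 3)) (freeExitTime (Torus.geometry (Fin 3)) (hsDiameter σ N) (lambertStateAfter (Torus.geometry (Fin 3)) (hsDiameter σ N) p.2 p.1 m)).toReal (lambertStateAfter (Torus.geometry (Fin 3)) (hsDiameter σ N) p.2 p.1 m))) (freeFlight (Torus.geometry (Fin 3)) (freeExitTime (Torus.geometry (Fin 3)) (hsDiameter σ N) (lambertStateAfter (Torus.geometry (Fin 3)) (hsDiameter σ N) p.2 p.1 m)).toReal (lambertStateAfter (Torus.geometry (Fin 3)) (hsDiameter σ N) p.2 p.1 m)) ξ) ∂(stdGaussian V3)) - F (lambertInstant (Torus.geometry (Fin 3)) (hsDiameter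 σ N) p.2 p.1 (m + 1)).toReal (freeFlight (Torus.geometry (Fin 3)) (freeExitTime (Torus.geometry (Fin 3)) (hsDiameter σ N) (lambertStateAfter (Torus.geometry (Fin 3)) (hsDiameter σ N) p.2 p.1 m)).toReal (lambertStateAfter (Torus.geometry (Fin 3)) (hsDiameter σ N) p.2 p.1 m)) else 0) ∂((localGibbsLaw σ a₀ u₀ θ₀ N Φ).prod (lambertNoise (Fin 3))) :=
    LambertianContactSwapLambertianEulerCollisionCompensator.integral_sum_jump_eq_sum_compensator hG hGm hFm hCf0 hFC
      (localGibbsLaw σ a₀ u₀ θ₀ N Φ) s (s + h) (fun _ _ => rfl) (fun _ _ => rfl) (fun _ _ => rfl) hInt hacc'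
  /- ── (5) the raw and compensated jump sums: measurable, dominated, integrable ── -/
  have hE0 : ∀ w : Config (N + 1) (Fin 3) T3, 0 ≤ 1 + configEnergy w := fun w =>
    add_nonneg zero_le_one (LambertianContactSwapLambertianEulerCollisionBudget.collisionBudget_configEnergy_nonneg w)
  have hFE : ∀ (t : ℝ) (w : Config (N + 1) (Fin 3) T3) (e : ℝ), configEnergy w ≤ e → |F t w| ≤ Cg * ((N : ℝ) + 3) * (1 + e) :=
    fun t w e hw => (hFC t w).trans (mul_le_mul_of_nonneg_left (add_le_add le_rfl hw) hCf0)
  have hΦm : ∀ m, Measurable fun p : Config (N + 1) (Fin 3) T3 × (ℕ → V3) =>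
      if s < (lambertInstant (Torus.geometry (Fin 3)) (hsDiameter σ N) p.2 p.1 (m + 1)).toReal then F (lambertInstant (Torus.geometry (Fin 3)) (hsDiameter σ N) p.2 p.1 (m + 1)).toReal (lambertStateAfter (Torus.geometry (Fin 3)) (hsDiameter σ N) p.2 p.1 (m + 1)) - F (lambertInstant (Torus.geometry (Fin 3)) (hsDiameter σ N) p.2 p.1 (m + 1)).toReal (freeFlight (Torus.geometry (Fin 3)) (freeExitTime (Torus.geometry (Fin 3)) (hsDiameter σ N) (lambertStateAfter (Torus.geometry (Fin 3)) (hsDiameter σ N) p.2 p.1 m)).toReal (lambertStateAfter (Torus.geometry (Fin 3)) (hsDiameter σ N) p.2 p.1 m)) else 0 := fun m =>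
    Measurable.ite (measurableSet_lt measurable_const (hTm m))
      ((hFm.comp ((hTm m).prodMk (hZsm m))).sub (hFm.comp ((hTm m).prodMk (hZpm m)))) measurable_const
  have hIm : ∀ m, Measurable fun p : Config (N + 1) (Fin 3) T3 × (ℕ → V3) =>
      ∫ ξ, F (lambertInstant (Torus.geometry (Fin 3)) (hsDiameter σ N) p.2 p.1 (m + 1)).toReal (lambertStepMap (Torus.geometry (Fin 3)) (incomingPairs (Torus.geometry (Fin 3)) (hsDiameter σ N) (freeFlight (Torus.geometry (Fin 3)) (freeExitTime (Torus.geometry (Fin 3)) (hsDiameter σ N) (lambertStateAfter (Torus.geometry (Fin 3)) (hsDiameter σ N) p.2 p.1 m)).toReal (lambertStateAfter (Torus.geometry (Fin 3)) (hsDiameter σ N) p.2 p.1 m))) (freeFlight (Torus.geometry (Fin 3)) (freeExitTime (Torus.geometry (Fin 3)) (hsDiameter σ N) (lambertStateAfter (Torus.geometry (Fin 3)) (hsDiameter σ N) p.2 p.1 m)).toReal (lambertStateAfter (Torus.geometry (Fin 3)) (hsDiameter σ N) p.2 p.1 m)) ξ) ∂(stdGaussian V3) :=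
    fun m => ((hFm.comp (((hTm m).comp measurable_fst).prodMk (measurable_lambertStepMap_incomingPairs
      hGm ((hZpm m).comp measurable_fst) measurable_snd))).stronglyMeasurable.integral_prod_right'
      (ν := stdGaussian V3)).measurable
  have hΨm : ∀ m, Measurable fun p : Config (N + 1) (Fin 3) T3 × (ℕ → V3) => if s < (lambertInstant (Torus.geometry (Fin 3)) (hsDiameter σ N) p.2 p.1 (m + 1)).toReal then (∫ ξ, F (lambertInstant (Torus.geometry (Fin 3)) (hsDiameter σ N) p.2 p.1 (m + 1)).toReal (lambertStepMap (Torus.geometry (Fin 3))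
      (incomingPairs (Torus.geometry (Fin 3)) (hsDiameter σ N) (freeFlight (Torus.geometry (Fin 3)) (freeExitTime (Torus.geometry (Fin 3)) (hsDiameter σ N) (lambertStateAfter (Torus.geometry (Fin 3)) (hsDiameter σ N) p.2 p.1 m)).toReal (lambertStateAfter (Torus.geometry (Fin 3)) (hsDiameter σ N) p.2 p.1 m))) (freeFlight (Torus.geometry (Fin 3)) (freeExitTime (Torus.geometry (Fin 3)) (hsDiameter σ N) (lambertStateAfter (Torus.geometry (Fin 3)) (hsDiameter σ N) p.2 p.1 m)).toReal (lambertStateAfter (Torus.geometry (Fin 3)) (hsDiameter σ N) p.2 p.1 m)) ξ) ∂(stdGaussian V3)) - F (lambertInstant (Torus.geometry (Fin 3)) (hsDiameter σ N) p.2 p.1 (m + 1)).toReal (freeFlight (Torus.geometry (Fin 3)) (freeExitTime (Torus.geometry (Fin 3)) (hsDiameter σ N) (lambertStateAfter (Torus.geometry (Fin 3)) (hsDiameter σ N) p.2 p.1 m)).toReal (lambertStateAfter (Torus.geometry (Fin 3)) (hsDiameter σ N) p.2 p.1 m)) else 0 :=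
    fun m => Measurable.ite (measurableSet_lt measurable_const (hTm m))
      ((hIm m).sub (hFm.comp ((hTm m).prodMk (hZpm m)))) measurable_const
  have hΦD : ∀ (m : ℕ) (p : Config (N + 1) (Fin 3) T3 × (ℕ → V3)), |(if s < (lambertInstant (Torus.geometry (Fin 3)) (hsDiameter σ N) p.2 p.1 (m + 1)).toReal then F (lambertInstant (Torus.geometry (Fin 3)) (hsDiameter σ N) p.2 p.1 (m + 1)).toReal (lambertStateAfter (Torus.geometry (Fin 3)) (hsDiameter σ N) p.2 p.1 (m + 1)) - F (lambertInstant (Torus.geometry (Fin 3)) (hsDiameter σ N) p.2 p.1 (m + 1)).toReal (freeFlight (Torus.geometry (Fin 3)) (freeExitTime (Torus.geometry (Fin 3)) (hsDiameter σ N) (lambertStateAfter (Torus.geometry (Fin 3)) (hsDiameter σ N) p.2 p.1 m)).toReal (lambertStateAfter (Torus.geometry (Fin 3)) (hsDiameter σ N) p.2 p.1 m)) else 0)| ≤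
      2 * (Cg * ((N : ℝ) + 3) * (1 + configEnergy p.1)) := fun m p =>
    LambertianContactSwapLambertianEulerCollisionCompensator.abs_ite_sub_le (hFE _ _ _ (hEZs m p)) (hFE _ _ _ (hEZp m p))
  have hΨD : ∀ (m : ℕ) (p : Config (N + 1) (Fin 3) T3 × (ℕ → V3)), |(if s < (lambertInstant (Torus.geometry (Fin 3)) (hsDiameter σ N) p.2 p.1 (m + 1)).toReal then (∫ ξ, F (lambertInstant (Torus.geometry (Fin 3)) (hsDiameter σ N) p.2 p.1 (m + 1)).toReal (lambertStepMap (Torus.geometry (Fin 3)) (incomingPairs (Torus.geometry (Fin 3)) (hsDiameter σ N) (freeFlight (Torus.geometry (Fin 3)) (freeExitTime (Torus.geometry (Fin 3)) (hsDiameter σ N) (lambertStateAfter (Torus.geometry (Fin 3)) (hsDiameter σ N) p.2 p.1 m)).toReal (lambertStateAfter (Torus.geometry (Fin 3)) (hsDiameter σ N) p.2 p.1 m)))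
      (freeFlight (Torus.geometry (Fin 3)) (freeExitTime (Torus.geometry (Fin 3)) (hsDiameter σ N) (lambertStateAfter (Torus.geometry (Fin 3)) (hsDiameter σ N) p.2 p.1 m)).toReal (lambertStateAfter (Torus.geometry (Fin 3)) (hsDiameter σ N) p.2 p.1 m)) ξ) ∂(stdGaussian V3)) - F (lambertInstant (Torus.geometry (Fin 3)) (hsDiameter σ N) p.2 p.1 (m + 1)).toReal (freeFlight (Torus.geometry (Fin 3)) (freeExitTime (Torus.geometry (Fin 3)) (hsDiameter σ N) (lambertStateAfter (Torus.geometry (Fin 3)) (hsDiameter σ N) p.2 p.1 m)).toReal (lambertStateAfter (Torus.geometry (Fin 3)) (hsDiameter σ N) p.2 p.1 m)) else 0)| ≤ 2 * (Cg * ((N : ℝ) + 3) * (1 + configEnergy p.1)) := by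
    intro m p
    refine LambertianContactSwapLambertianEulerCollisionCompensator.abs_ite_sub_le ?_ (hFE _ _ _ (hEZp m p))
    have hb := norm_integral_le_of_norm_le_const (μ := stdGaussian V3)
      (f := fun ξ => F (lambertInstant (Torus.geometry (Fin 3)) (hsDiameter σ N) p.2 p.1 (m + 1)).toReal (lambertStepMap (Torus.geometry (Fin 3)) (incomingPairs (Torus.geometry (Fin 3)) (hsDiameter σ N) (freeFlight (Torus.geometry (Fin 3)) (freeExitTime (Torus.geometry (Fin 3)) (hsDiameter σ N) (lambertStateAfter (Torus.geometry (Fin 3)) (hsDiameter σ N) p.2 p.1 m)).toReal (lambertStateAfter (Torus.geometry (Fin 3)) (hsDiameter σ N) p.2 p.1 m))) (freeFlight (Torus.geometry (Fin 3)) (freeExitTime (Torus.geometry (Fin 3)) (hsDiameter σ N) (lambertStateAfter (Torus.geometry (Fin 3)) (hsDiameter σ N) p.2 p.1 m)).toReal (lambertStateAfter (Torus.geometry (Fin 3)) (hsDiameter σ N) p.2 p.1 m)) ξ))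
      (C := Cg * ((N : ℝ) + 3) * (1 + configEnergy p.1)) (Eventually.of_forall fun ξ => ?_)
    · rwa [probReal_univ, mul_one, Real.norm_eq_abs] at hb
    · rw [Real.norm_eq_abs]
      exact hFE _ _ _ ((LambertianContactSwapLambertianEulerCollisionCompensator.configEnergy_lambertStepMap_le _ _).trans (hEZp m p))
  -- the dominating function `2 C (K + 1)(1 + E)`
  have hDint : Integrable (fun p : Config (N + 1) (Fin 3) T3 × (ℕ → V3) => (lambertCount (Torus.geometry (Fin 3)) (hsDiameter σ N) p.2 p.1 (s + h) : ℝ) * (2 * (Cg * ((N : ℝ) + 3) * (1 + configEnergy p.1)))) ((localGibbsLaw σ a₀ u₀ θ₀ N Φ).prod (lambertNoise (Fin 3))) := by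
    refine (hInt.const_mul (2 * (Cg * ((N : ℝ) + 3)))).mono' ?_ (Eventually.of_forall fun p => ?_)
    · exact ((measurable_from_nat (f := fun n : ℕ => (n : ℝ)) |>.comp hKm).mul (measurable_const.mul
        (measurable_const.mul (measurable_const.add ((measurable_configEnergy.comp measurable_fst)))))).aestronglyMeasurable
    · rw [Real.norm_of_nonneg (mul_nonneg (Nat.cast_nonneg _) (mul_nonneg zero_le_two (mul_nonneg hCf0 (hE0 p.1))))]
      have hK0 : (0 : ℝ) ≤ (lambertCount (Torus.geometry (Fin 3)) (hsDiameter σ N) p.2 p.1 (s + h) : ℝ) := Nat.cast_nonneg _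
      nlinarith [mul_nonneg hCf0 (hE0 p.1), hK0]
  have hRawF : Integrable (fun p : Config (N + 1) (Fin 3) T3 × (ℕ → V3) => ∑ m ∈ Finset.range (lambertCount (Torus.geometry (Fin 3)) (hsDiameter σ N) p.2 p.1 (s + h)),
      (if s < (lambertInstant (Torus.geometry (Fin 3)) (hsDiameter σ N) p.2 p.1 (m + 1)).toReal then F (lambertInstant (Torus.geometry (Fin 3)) (hsDiameter σ N) p.2 p.1 (m + 1)).toReal (lambertStateAfter (Torus.geometry (Fin 3)) (hsDiameter σ N) p.2 p.1 (m + 1)) - F (lambertInstant (Torus.geometry (Fin 3)) (hsDiameter σ N) p.2 p.1 (m + 1)).toReal (freeFlight (Torus.geometry (Fin 3)) (freeExitTime (Torus.geometry (Fin 3)) (hsDiameter σ N) (lambertStateAfter (Torus.geometry (Fin 3)) (hsDiameter σ N) p.2 p.1 m)).toReal (lambertStateAfter (Torus.geometry (Fin 3)) (hsDiameter σ N) p.2 p.1 m)) else 0)) ((localGibbsLaw σ a₀ u₀ θ₀ N Φ).prod (lambertNoise (Fin 3))) :=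
    hDint.mono' (measurable_sum_range_real hKm hΦm).aestronglyMeasurable (Eventually.of_forall fun p =>
      (Real.norm_eq_abs _).trans_le (abs_sum_range_le_mul fun m => hΦD m p))
  have hCompF : Integrable (fun p : Config (N + 1) (Fin 3) T3 × (ℕ → V3) => ∑ m ∈ Finset.range (lambertCount (Torus.geometry (Fin 3)) (hsDiameter σ N) p.2 p.1 (s + h)), (if s < (lambertInstant (Torus.geometry (Fin 3)) (hsDiameter σ N) p.2 p.1 (m + 1)).toReal then
      (∫ ξ, F (lambertInstant (Torus.geometry (Fin 3)) (hsDiameter σ N) p.2 p.1 (m + 1)).toReal (lambertStepMap (Torus.geometry (Fin 3)) (incomingPairs (Torus.geometry (Fin 3)) (hsDiameter σ N) (freeFlight (Torus.geometry (Fin 3)) (freeExitTime (Torus.geometry (Fin 3)) (hsDiameter σ N) (lambertStateAfter (Torus.geometry (Fin 3)) (hsDiameter σ N) p.2 p.1 m)).toReal (lambertStateAfter (Torus.geometry (Fin 3)) (hsDiameter σ N) p.2 p.1 m))) (freeFlight (Torus.geometry (Fin 3)) (freeExitTime (Torus.geometry (Fin 3)) (hsDiameter σ N) (lambertStateAfter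 (Torus.geometry (Fin 3)) (hsDiameter σ N) p.2 p.1 m)).toReal (lambertStateAfter (Torus.geometry (Fin 3)) (hsDiameter σ N) p.2 p.1 m)) ξ) ∂(stdGaussian V3)) -
        F (lambertInstant (Torus.geometry (Fin 3)) (hsDiameter σ N) p.2 p.1 (m + 1)).toReal (freeFlight (Torus.geometry (Fin 3)) (freeExitTime (Torus.geometry (Fin 3)) (hsDiameter σ N) (lambertStateAfter (Torus.geometry (Fin 3)) (hsDiameter σ N) p.2 p.1 m)).toReal (lambertStateAfter (Torus.geometry (Fin 3)) (hsDiameter σ N) p.2 p.1 m)) else 0)) ((localGibbsLaw σ a₀ u₀ θ₀ N Φ).prod (lambertNoise (Fin 3))) :=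
    hDint.mono' (measurable_sum_range_real hKm hΨm).aestronglyMeasurable (Eventually.of_forall fun p =>
      (Real.norm_eq_abs _).trans_le (abs_sum_range_le_mul fun m => hΨD m p))
  -- on the full-measure set the clamp is invisible: the `F`-sums are the `g`-sums of the statement
  have hRaw_eq : ∀ᵐ p ∂((localGibbsLaw σ a₀ u₀ θ₀ N Φ).prod (lambertNoise (Fin 3))), (∑ m ∈ Finset.range (lambertCount (Torus.geometry (Fin 3)) (hsDiameter σ N) p.2 p.1 (s + h)), (if s < (lambertInstant (Torus.geometry (Fin 3)) (hsDiameter σ N) p.2 p.1 (m + 1)).toReal then F (lambertInstant (Torus.geometry (Fin 3)) (hsDiameter σ N) p.2 p.1 (m + 1)).toReal (lambertStateAfter (Torus.geometry (Fin 3)) (hsDiameter σ N) p.2 p.1 (m + 1)) - F (lambertInstant (Torus.geometry (Fin 3)) (hsDiameter σ N) p.2 p.1 (m + 1)).toReal (freeFlight (Torus.geometry (Fin 3)) (freeExitTime (Torus.geometry (Fin 3)) (hsDiameter σ N) (lambertStateAfter (Torus.geometry (Fin 3)) (hsDiameter σ N) p.2 p.1 m)).toReal (lambertStateAfter (Torus.geometry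 (Fin 3)) (hsDiameter σ N) p.2 p.1 m)) else 0)) =
      ∑ m ∈ Finset.range (lambertCount (Torus.geometry (Fin 3)) (hsDiameter σ N) p.2 p.1 (s + h)), (if s < (lambertInstant (Torus.geometry (Fin 3)) (hsDiameter σ N) p.2 p.1 (m + 1)).toReal then gSum a θ u (lambertInstant (Torus.geometry (Fin 3)) (hsDiameter σ N) p.2 p.1 (m + 1)).toReal (lambertStateAfter (Torus.geometry (Fin 3)) (hsDiameter σ N) p.2 p.1 (m + 1)) - gSum a θ u (lambertInstant (Torus.geometry (Fin 3)) (hsDiameter σ N) p.2 p.1 (m + 1)).toReal (freeFlight (Torus.geometry (Fin 3)) (freeExitTime (Torus.geometry (Fin 3)) (hsDiameter σ N) (lambertStateAfter (Torus.geometry (Fin 3)) (hsDiameter σ N) p.2 p.1 m)).toReal (lambertStateAfter (Torus.geometry (Fin 3)) (hsDiameter σ N) p.2 p.1 m)) else 0) := by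
    filter_upwards [hacc'] with p hp
    refine Finset.sum_congr rfl fun m hm => ?_
    by_cases hsm : s < (lambertInstant (Torus.geometry (Fin 3)) (hsDiameter σ N) p.2 p.1 (m + 1)).toReal
    · have hW := hT1W p hp m (Finset.mem_range.1 hm) hsm
      simp only [if_pos hsm, hFt _ hW]
    · rw [if_neg hsm, if_neg hsm]
  have hComp_eq : ∀ᵐ p ∂((localGibbsLaw σ a₀ u₀ θ₀ N Φ).prod (lambertNoise (Fin 3))), (∑ m ∈ Finset.range (lambertCount (Torus.geometry (Fin 3)) (hsDiameter σ N) p.2 p.1 (s + h)), (if s < (lambertInstant (Torus.geometry (Fin 3)) (hsDiameter σ N) p.2 p.1 (m + 1)).toReal then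
      (∫ ξ, F (lambertInstant (Torus.geometry (Fin 3)) (hsDiameter σ N) p.2 p.1 (m + 1)).toReal (lambertStepMap (Torus.geometry (Fin 3)) (incomingPairs (Torus.geometry (Fin 3)) (hsDiameter σ N) (freeFlight (Torus.geometry (Fin 3)) (freeExitTime (Torus.geometry (Fin 3)) (hsDiameter σ N) (lambertStateAfter (Torus.geometry (Fin 3)) (hsDiameter σ N) p.2 p.1 m)).toReal (lambertStateAfter (Torus.geometry (Fin 3)) (hsDiameter σ N) p.2 p.1 m))) (freeFlight (Torus.geometry (Fin 3)) (freeExitTime (Torus.geometry (Fin 3)) (hsDiameter σ N) (lambertStateAfter (Torus.geometry (Fin 3)) (hsDiameter σ N) p.2 p.1 m)).toReal (lambertStateAfter (Torus.geometry (Fin 3)) (hsDiameter σ N) p.2 p.1 m)) ξ) ∂(stdGaussian V3)) -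
        F (lambertInstant (Torus.geometry (Fin 3)) (hsDiameter σ N) p.2 p.1 (m + 1)).toReal (freeFlight (Torus.geometry (Fin 3)) (freeExitTime (Torus.geometry (Fin 3)) (hsDiameter σ N) (lambertStateAfter (Torus.geometry (Fin 3)) (hsDiameter σ N) p.2 p.1 m)).toReal (lambertStateAfter (Torus.geometry (Fin 3)) (hsDiameter σ N) p.2 p.1 m)) else 0)) =
      ∑ m ∈ Finset.range (lambertCount (Torus.geometry (Fin 3)) (hsDiameter σ N) p.2 p.1 (s + h)), (if s < (lambertInstant (Torus.geometry (Fin 3)) (hsDiameter σ N) p.2 p.1 (m + 1)).toReal then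
        (∫ ξ, gSum a θ u (lambertInstant (Torus.geometry (Fin 3)) (hsDiameter σ N) p.2 p.1 (m + 1)).toReal (lambertStepMap (Torus.geometry (Fin 3)) (incomingPairs (Torus.geometry (Fin 3)) (hsDiameter σ N) (freeFlight (Torus.geometry (Fin 3)) (freeExitTime (Torus.geometry (Fin 3)) (hsDiameter σ N) (lambertStateAfter (Torus.geometry (Fin 3)) (hsDiameter σ N) p.2 p.1 m)).toReal (lambertStateAfter (Torus.geometry (Fin 3)) (hsDiameter σ N) p.2 p.1 m))) (freeFlight (Torus.geometry (Fin 3)) (freeExitTime (Torus.geometry (Fin 3)) (hsDiameter σ N) (lambertStateAfter (Torus.geometry (Fin 3)) (hsDiameter σ N) p.2 p.1 m)).toReal (lambertStateAfter (Torus.geometry (Fin 3)) (hsDiameter σ N) p.2 p.1 m)) ξ) ∂(stdGaussian V3)) -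
          gSum a θ u (lambertInstant (Torus.geometry (Fin 3)) (hsDiameter σ N) p.2 p.1 (m + 1)).toReal (freeFlight (Torus.geometry (Fin 3)) (freeExitTime (Torus.geometry (Fin 3)) (hsDiameter σ N) (lambertStateAfter (Torus.geometry (Fin 3)) (hsDiameter σ N) p.2 p.1 m)).toReal (lambertStateAfter (Torus.geometry (Fin 3)) (hsDiameter σ N) p.2 p.1 m)) else 0) := by
    filter_upwards [hacc'] with p hp
    refine Finset.sum_congr rfl fun m hm => ?_
    by_cases hsm : s < (lambertInstant (Torus.geometry (Fin 3)) (hsDiameter σ N) p.2 p.1 (m + 1)).toReal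
    · have hW := hT1W p hp m (Finset.mem_range.1 hm) hsm
      simp only [if_pos hsm, hFt _ hW]
    · rw [if_neg hsm, if_neg hsm]
  have hRaw : Integrable (fun p : Config (N + 1) (Fin 3) T3 × (ℕ → V3) => ∑ m ∈ Finset.range (lambertCount (Torus.geometry (Fin 3)) (hsDiameter σ N) p.2 p.1 (s + h)),
      (if s < (lambertInstant (Torus.geometry (Fin 3)) (hsDiameter σ N) p.2 p.1 (m + 1)).toReal then gSum a θ u (lambertInstant (Torus.geometry (Fin 3)) (hsDiameter σ N) p.2 p.1 (m + 1)).toReal (lambertStateAfter (Torus.geometry (Fin 3)) (hsDiameter σ N) p.2 p.1 (m + 1)) - gSum a θ u (lambertInstant (Torus.geometry (Fin 3)) (hsDiameter σ N) p.2 p.1 (m + 1)).toReal (freeFlight (Torus.geometry (Fin 3)) (freeExitTime (Torus.geometry (Fin 3)) (hsDiameter σ N) (lambertStateAfter (Torus.geometry (Fin 3)) (hsDiameter σ N) p.2 p.1 m)).toReal (lambertStateAfter (Torus.geometry (Fin 3)) (hsDiameter σ N) p.2 p.1 m)) else 0)) ((localGibbsLaw σ a₀ u₀ θ₀ N Φ).prod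 (lambertNoise (Fin 3))) :=
    hRawF.congr hRaw_eq
  have hComp : Integrable (fun p : Config (N + 1) (Fin 3) T3 × (ℕ → V3) => ∑ m ∈ Finset.range (lambertCount (Torus.geometry (Fin 3)) (hsDiameter σ N) p.2 p.1 (s + h)), (if s < (lambertInstant (Torus.geometry (Fin 3)) (hsDiameter σ N) p.2 p.1 (m + 1)).toReal then
      (∫ ξ, gSum a θ u (lambertInstant (Torus.geometry (Fin 3)) (hsDiameter σ N) p.2 p.1 (m + 1)).toReal (lambertStepMap (Torus.geometry (Fin 3)) (incomingPairs (Torus.geometry (Fin 3)) (hsDiameter σ N) (freeFlight (Torus.geometry (Fin 3)) (freeExitTime (Torus.geometry (Fin 3)) (hsDiameter σ N) (lambertStateAfter (Torus.geometry (Fin 3)) (hsDiameter σ N) p.2 p.1 m)).toReal (lambertStateAfter (Torus.geometry (Fin 3)) (hsDiameter σ N) p.2 p.1 m))) (freeFlight (Torus.geometry (Fin 3)) (freeExitTime (Torus.geometry (Fin 3)) (hsDiameter σ N) (lambertStateAfter (Torus.geometry (Fin 3)) (hsDiameter σ N) p.2 p.1 m)).toReal (lambertStateAfter (Torus.geometry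 (Fin 3)) (hsDiameter σ N) p.2 p.1 m)) ξ) ∂(stdGaussian V3)) -
        gSum a θ u (lambertInstant (Torus.geometry (Fin 3)) (hsDiameter σ N) p.2 p.1 (m + 1)).toReal (freeFlight (Torus.geometry (Fin 3)) (freeExitTime (Torus.geometry (Fin 3)) (hsDiameter σ N) (lambertStateAfter (Torus.geometry (Fin 3)) (hsDiameter σ N) p.2 p.1 m)).toReal (lambertStateAfter (Torus.geometry (Fin 3)) (hsDiameter σ N) p.2 p.1 m)) else 0)) ((localGibbsLaw σ a₀ u₀ θ₀ N Φ).prod (lambertNoise (Fin 3))) :=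
    hCompF.congr hComp_eq
  have hcomp' : ∫ p, (∑ m ∈ Finset.range (lambertCount (Torus.geometry (Fin 3)) (hsDiameter σ N) p.2 p.1 (s + h)),
      (if s < (lambertInstant (Torus.geometry (Fin 3)) (hsDiameter σ N) p.2 p.1 (m + 1)).toReal then gSum a θ u (lambertInstant (Torus.geometry (Fin 3)) (hsDiameter σ N) p.2 p.1 (m + 1)).toReal (lambertStateAfter (Torus.geometry (Fin 3)) (hsDiameter σ N) p.2 p.1 (m + 1)) - gSum a θ u (lambertInstant (Torus.geometry (Fin 3)) (hsDiameter σ N) p.2 p.1 (m + 1)).toReal (freeFlight (Torus.geometry (Fin 3)) (freeExitTime (Torus.geometry (Fin 3)) (hsDiameter σ N) (lambertStateAfter (Torus.geometry (Fin 3)) (hsDiameter σ N) p.2 p.1 m)).toReal (lambertStateAfter (Torus.geometry (Fin 3)) (hsDiameter σ N) p.2 p.1 m)) else 0)) ∂((localGibbsLaw σ a₀ u₀ θ₀ N Φ).prod (lambertNoise (Fin 3))) =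
      ∫ p, (∑ m ∈ Finset.range (lambertCount (Torus.geometry (Fin 3)) (hsDiameter σ N) p.2 p.1 (s + h)), (if s < (lambertInstant (Torus.geometry (Fin 3)) (hsDiameter σ N) p.2 p.1 (m + 1)).toReal then
        (∫ ξ, gSum a θ u (lambertInstant (Torus.geometry (Fin 3)) (hsDiameter σ N) p.2 p.1 (m + 1)).toReal (lambertStepMap (Torus.geometry (Fin 3)) (incomingPairs (Torus.geometry (Fin 3)) (hsDiameter σ N) (freeFlight (Torus.geometry (Fin 3)) (freeExitTime (Torus.geometry (Fin 3)) (hsDiameter σ N) (lambertStateAfter (Torus.geometry (Fin 3)) (hsDiameter σ N) p.2 p.1 m)).toReal (lambertStateAfter (Torus.geometry (Fin 3)) (hsDiameter σ N) p.2 p.1 m))) (freeFlight (Torus.geometry (Fin 3)) (freeExitTime (Torus.geometry (Fin 3)) (hsDiameter σ N) (lambertStateAfter (Torus.geometry (Fin 3)) (hsDiameter σ N) p.2 p.1 m)).toReal (lambertStateAfter (Torus.geometry (Fin 3)) (hsDiameter σ N) p.2 p.1 m)) ξ) ∂(stdGaussian V3)) -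
          gSum a θ u (lambertInstant (Torus.geometry (Fin 3)) (hsDiameter σ N) p.2 p.1 (m + 1)).toReal (freeFlight (Torus.geometry (Fin 3)) (freeExitTime (Torus.geometry (Fin 3)) (hsDiameter σ N) (lambertStateAfter (Torus.geometry (Fin 3)) (hsDiameter σ N) p.2 p.1 m)).toReal (lambertStateAfter (Torus.geometry (Fin 3)) (hsDiameter σ N) p.2 p.1 m)) else 0)) ∂((localGibbsLaw σ a₀ u₀ θ₀ N Φ).prod (lambertNoise (Fin 3))) := by
    rw [← integral_congr_ae hRaw_eq, ← integral_congr_ae hComp_eq]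
    exact hcomp
  /- ── (6) the pathwise identity, a.e. ── -/
  have hpath : ∀ᵐ p ∂((localGibbsLaw σ a₀ u₀ θ₀ N Φ).prod (lambertNoise (Fin 3))), gSum a θ u (s + h) (lambertFlow (Torus.geometry (Fin 3)) (hsDiameter σ N) p.2 p.1 (s + h)) - gSum a θ u s (lambertFlow (Torus.geometry (Fin 3)) (hsDiameter σ N) p.2 p.1 s) =
      (∫ r in s..(s + h), DgSum T a θ u r (lambertFlow (Torus.geometry (Fin 3)) (hsDiameter σ N) p.2 p.1 r)) +
        ∑ m ∈ Finset.range (lambertCount (Torus.geometry (Fin 3)) (hsDiameter σ N) p.2 p.1 (s + h)), (if s < (lambertInstant (Torus.geometry (Fin 3)) (hsDiameter σ N) p.2 p.1 (m + 1)).toReal then gSum a θ u (lambertInstant (Torus.geometry (Fin 3)) (hsDiameter σ N) p.2 p.1 (m + 1)).toReal (lambertStateAfter (Torus.geometry (Fin 3)) (hsDiameter σ N) p.2 p.1 (m + 1)) - gSum a θ u (lambertInstant (Torus.geometry (Fin 3)) (hsDiameter σ N) p.2 p.1 (m + 1)).toReal (freeFlight (Torus.geometry (Fin 3)) (freeExitTime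 (Torus.geometry (Fin 3)) (hsDiameter σ N) (lambertStateAfter (Torus.geometry (Fin 3)) (hsDiameter σ N) p.2 p.1 m)).toReal (lambertStateAfter (Torus.geometry (Fin 3)) (hsDiameter σ N) p.2 p.1 m)) else 0) := by
    filter_upwards [hacc'] with p hp
    have hpw := LambertianContactSwapLambertianEulerPathwiseProduction.stub_pathwiseProductionLambda hσ hσ' T N a θ u ha hθ hu
      ha0 hθ0 p.1 p.2 s h hs hh hshT hp
    simp only [gSum, gExp, DgSum, DgExp] at hpw ⊢
    exact hpw
  /- ── (7) the streaming integral: a.e.-measurable as a difference, dominated by cubic growth ── -/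
  have hStrm : AEStronglyMeasurable (fun p : Config (N + 1) (Fin 3) T3 × (ℕ → V3) => ∫ r in s..(s + h), DgSum T a θ u r (lambertFlow (Torus.geometry (Fin 3)) (hsDiameter σ N) p.2 p.1 r)) ((localGibbsLaw σ a₀ u₀ θ₀ N Φ).prod (lambertNoise (Fin 3))) := by
    refine (((hGint hbW).aestronglyMeasurable.sub (hGint hsW).aestronglyMeasurable).sub hRaw.aestronglyMeasurable).congr ?_
    filter_upwards [hpath] with p hp
    simp only [Pi.sub_apply, hp, add_sub_cancel_right]
  obtain ⟨Cd, hCd0, hCd⟩ := ClampedCurrentsDockWindowBalance.exists_abs_DgExp_le ha hθ hu ha0 hθ0 hs hshT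
  have hbound : Integrable (fun p : Config (N + 1) (Fin 3) T3 × (ℕ → V3) => ((N : ℝ) + 1) * Cd *
      (3 + 5 * ∑ i, ‖(p.1 i).2‖ ^ 2 + ((N : ℝ) + 1) * ∑ i, ‖(p.1 i).2‖ ^ 4) * h) ((localGibbsLaw σ a₀ u₀ θ₀ N Φ).prod (lambertNoise (Fin 3))) := by
    refine Integrable.mul_const (Integrable.const_mul (((integrable_const _).add ?_).add ?_) _) _
    · exact hE1.const_mul _
    · exact hE4.const_mul _
  have hStr : Integrable (fun p : Config (N + 1) (Fin 3) T3 × (ℕ → V3) => ∫ r in s..(s + h), DgSum T a θ u r (lambertFlow (Torus.geometry (Fin 3)) (hsDiameter σ N) p.2 p.1 r)) ((localGibbsLaw σ a₀ u₀ θ₀ N Φ).prod (lambertNoise (Fin 3))) := by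
    refine hbound.mono' hStrm (Eventually.of_forall fun p => ?_)
    have hCS : (∑ i, ‖(p.1 i).2‖ ^ 2) ^ 2 ≤ ((N : ℝ) + 1) * ∑ i, ‖(p.1 i).2‖ ^ 4 := by
      have hcs := sq_sum_le_card_mul_sum_sq (s := Finset.univ) (f := fun i : Fin (N + 1) => ‖(p.1 i).2‖ ^ 2)
      simpa only [Finset.card_univ, Fintype.card_fin, Nat.cast_add, Nat.cast_one, ← pow_mul] using hcs
    have hS0 : 0 ≤ ∑ i, ‖(p.1 i).2‖ ^ 2 := Finset.sum_nonneg fun i _ => by positivity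
    have hKr : ∀ r ∈ Set.uIoc s (s + h), ‖DgSum T a θ u r (lambertFlow (Torus.geometry (Fin 3)) (hsDiameter σ N) p.2 p.1 r)‖ ≤
        ((N : ℝ) + 1) * Cd * (3 + 5 * ∑ i, ‖(p.1 i).2‖ ^ 2 + ((N : ℝ) + 1) * ∑ i, ‖(p.1 i).2‖ ^ 4) := by
      intro r hr
      rw [Set.uIoc_of_le hsb] at hr
      rw [Real.norm_eq_abs]
      refine (ClampedCurrentsDockWindowBalance.abs_DgSum_le hCd0 (hCd r (Set.Ioc_subset_Icc_self hr)) _).trans ?_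
      have hm := hEmono p r
      have hN0 : (0 : ℝ) ≤ ((N : ℝ) + 1) * Cd := by positivity
      refine mul_le_mul_of_nonneg_left ?_ hN0
      nlinarith [hm, hCS, Finset.sum_nonneg (fun i (_ : i ∈ Finset.univ) => (by positivity : (0 : ℝ) ≤ ‖((lambertFlow (Torus.geometry (Fin 3)) (hsDiameter σ N) p.2 p.1 r) i).2‖ ^ 2)),
        mul_le_mul hm hm (Finset.sum_nonneg (fun i (_ : i ∈ Finset.univ) => (by positivity : (0 : ℝ) ≤ ‖((lambertFlow (Torus.geometry (Fin 3)) (hsDiameter σ N) p.2 p.1 r) i).2‖ ^ 2))) hS0]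
    calc ‖∫ r in s..(s + h), DgSum T a θ u r (lambertFlow (Torus.geometry (Fin 3)) (hsDiameter σ N) p.2 p.1 r)‖
        ≤ ((N : ℝ) + 1) * Cd * (3 + 5 * ∑ i, ‖(p.1 i).2‖ ^ 2 + ((N : ℝ) + 1) * ∑ i, ‖(p.1 i).2‖ ^ 4) * |s + h - s| :=
          intervalIntegral.norm_integral_le_of_norm_le_const hKr
      _ = _ := by rw [add_sub_cancel_left, abs_of_nonneg hh]
  /- ── (8) assembly ── -/
  refine ⟨hStr, hComp, ?_⟩
  -- two-time law: the restarted window expectation along one trajectory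
  have hF₂m : Measurable fun w : Config (N + 1) (Fin 3) T3 × Config (N + 1) (Fin 3) T3 =>
      Real.log (canonicalDensity (Torus.geometry (Fin 3)) (hsDiameter σ N) (N + 1) (localGibbsProfile (a s) (u s) (θ s)) w.1) -
        Real.log (canonicalDensity (Torus.geometry (Fin 3)) (hsDiameter σ N) (N + 1) (localGibbsProfile (a (s + h)) (u (s + h)) (θ (s + h))) w.2) :=
    ((measurable_canonicalDensity _ _ (measurable_localGibbsProfile (hac (hIcc hsW)) (hθc (hIcc hsW)) (huc (hIcc hsW)))).comp
      measurable_fst).log.sub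
      (((measurable_canonicalDensity _ _ (measurable_localGibbsProfile (hac (hIcc hbW)) (hθc (hIcc hbW)) (huc (hIcc hbW)))).comp
        measurable_snd).log)
  have e2 : (∫ q, (Real.log (canonicalDensity (Torus.geometry (Fin 3)) (hsDiameter σ N) (N + 1)
        (localGibbsProfile (a s) (u s) (θ s)) q.1) -
      Real.log (canonicalDensity (Torus.geometry (Fin 3)) (hsDiameter σ N) (N + 1)
        (localGibbsProfile (a (s + h)) (u (s + h)) (θ (s + h)))
        (lambertFlow (Torus.geometry (Fin 3)) (hsDiameter σ N) q.2 q.1 h)))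
      ∂((((((localGibbsLaw σ a₀ u₀ θ₀ N Φ).prod (lambertNoise (Fin 3)))).map (fun p => lambertFlow (Torus.geometry (Fin 3)) (hsDiameter σ N) p.2 p.1 s))).prod (lambertNoise (Fin 3)))) =
      ∫ p, (Real.log (canonicalDensity (Torus.geometry (Fin 3)) (hsDiameter σ N) (N + 1) (localGibbsProfile (a s) (u s) (θ s)) (lambertFlow (Torus.geometry (Fin 3)) (hsDiameter σ N) p.2 p.1 s)) -
        Real.log (canonicalDensity (Torus.geometry (Fin 3)) (hsDiameter σ N) (N + 1) (localGibbsProfile (a (s + h)) (u (s + h)) (θ (s + h))) (lambertFlow (Torus.geometry (Fin 3)) (hsDiameter σ N) p.2 p.1 (s + h)))) ∂((localGibbsLaw σ a₀ u₀ θ₀ N Φ).prod (lambertNoise (Fin 3))) :=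
    integral_twoTime_eq hε hε' (localGibbsLaw σ a₀ u₀ θ₀ N Φ) hPL hs hh hF₂m
  rw [e2]
  -- explicit log-densities along the trajectory
  have e3 : ∫ p, (Real.log (canonicalDensity (Torus.geometry (Fin 3)) (hsDiameter σ N) (N + 1) (localGibbsProfile (a s) (u s) (θ s)) (lambertFlow (Torus.geometry (Fin 3)) (hsDiameter σ N) p.2 p.1 s)) -
      Real.log (canonicalDensity (Torus.geometry (Fin 3)) (hsDiameter σ N) (N + 1) (localGibbsProfile (a (s + h)) (u (s + h)) (θ (s + h))) (lambertFlow (Torus.geometry (Fin 3)) (hsDiameter σ N) p.2 p.1 (s + h)))) ∂((localGibbsLaw σ a₀ u₀ θ₀ N Φ).prod (lambertNoise (Fin 3))) =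
      ∫ p, ((Real.log (posPartition (a (s + h)) (hsDiameter σ N) (N + 1)) - Real.log (posPartition (a s) (hsDiameter σ N) (N + 1))) -
        (gSum a θ u (s + h) (lambertFlow (Torus.geometry (Fin 3)) (hsDiameter σ N) p.2 p.1 (s + h)) - gSum a θ u s (lambertFlow (Torus.geometry (Fin 3)) (hsDiameter σ N) p.2 p.1 s))) ∂((localGibbsLaw σ a₀ u₀ θ₀ N Φ).prod (lambertNoise (Fin 3))) := by
    refine integral_congr_ae ?_
    filter_upwards [hDom] with p hp
    rw [hlog hsW (hp s hs), hlog hbW (hp (s + h) (hs.trans hsb))]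
    ring
  have hΔ : Integrable (fun p : Config (N + 1) (Fin 3) T3 × (ℕ → V3) => gSum a θ u (s + h) (lambertFlow (Torus.geometry (Fin 3)) (hsDiameter σ N) p.2 p.1 (s + h)) - gSum a θ u s (lambertFlow (Torus.geometry (Fin 3)) (hsDiameter σ N) p.2 p.1 s)) ((localGibbsLaw σ a₀ u₀ θ₀ N Φ).prod (lambertNoise (Fin 3))) :=
    (hGint hbW).sub (hGint hsW)
  rw [e3, integral_sub (integrable_const _) hΔ, integral_const, probReal_univ, one_smul, integral_congr_ae hpath,
    integral_add hStr hRaw, hcomp']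
  ring

end Summit.AtomisticToContinuum.HydrodynamicLimit.Theorems.LambertianContactSwapLambertianEulerExpectedWindowProduction

end
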